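import Literature.Analysis.FluidPDE.CorrectorFourierDefs
import Literature.Analysis.FluidPDE.ScalarFourierPicard
import HarnessLib

/-!
# Fourier-side estimates for the linearised Navier–Stokes system (3.2) on `T^d`: symbols

Analysis/FluidPDE proof file, second of the files discharging
`Literature.Analysis.FluidPDE.Torus.CheskidovLuo2022LocalExistence` (objects in
`CorrectorFourierDefs`; Cheskidov–Luo 2022, §3.1, local solvability of (3.2)). Elementary
bookkeeping for the symbols, all on the frequency lattice `ℤ^d` with the sup norm and the
weights `(1 + ‖k‖)^{-K}` of `ScalarFourierFamily`:

* the Leray projector entries are bounded by `2`, real and even, annihilate the frequency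
  direction (`∑ₗ kₗ (P G)ₗ = 0`, i.e. the projected field is divergence free on the Fourier
  side), and the pressure coefficients close the system:
  `-(P G)ₗ + Gₗ + 2πikₗ q̂ = 0` (`projSym_pressure_identity`);
* **decay**: if the velocity coefficients `c`, the drift coefficients `U` decay to orders
  `2#d + 1` and `K + 1` and the stress coefficients to order `K + 1`, then `convSym` and
  `projSym` decay to order `K` with a constant *linear* in each order-`(K+1)` constant
  (`hasDecay_convSym`, `hasDecay_projSym`; one derivative lost, `hasDecay_transportSym`);
* **Lipschitz bounds** in the velocity coefficients (`convSym_sub`, `hasDecay_projSym_sub`);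
* **continuity** in time of `s ↦ projSym(U(s), RH(s), c(s))(l, k)` for continuous, uniformly
  decaying fields (`continuous_projSym_param`).

## References

* A. Cheskidov, X. Luo, arXiv:2009.06596, §3.1 (3.2). [`CheskidovLuo2022`]
* P. G. Lemarié-Rieusset, *The Navier–Stokes problem in the 21st century*, CRC 2016, §6.1, §8.5.
-/

noncomputable section

open MeasureTheory Real Set Filter Topology UnitAddTorus

namespace Literature.Analysis.FluidPDE

namespace CorrectorFourier

open ScalarFourier
open FourierNS (HasDecay clamp)
open Literature.Analysis.FunctionSpaces.Torus (freqNormSq)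

variable {d : Type*} [Fintype d] [DecidableEq d]

/-! ### The Leray projector: bounds and algebra -/

section Leray

omit [DecidableEq d] in
/-- `kₗ² ≤ |k|²`. [folklore] -/
theorem sq_apply_le_freqNormSq (k : d → ℤ) (l : d) : (k l : ℝ) ^ 2 ≤ freqNormSq k := by
  rw [FunctionSpaces.Torus.freqNormSq]
  exact Finset.single_le_sum (f := fun i => (k i : ℝ) ^ 2) (fun i _ => sq_nonneg _) (Finset.mem_univ l)

omit [DecidableEq d] in
/-- `|kₗ kₘ| ≤ |k|²`. [folklore] -/
theorem abs_mul_apply_le_freqNormSq (k : d → ℤ) (l m : d) :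
    |(k l : ℝ) * (k m : ℝ)| ≤ freqNormSq k := by
  rw [abs_mul]
  have hl := sq_apply_le_freqNormSq k l
  have hm := sq_apply_le_freqNormSq k m
  nlinarith [sq_abs (k l : ℝ), sq_abs (k m : ℝ), abs_nonneg (k l : ℝ), abs_nonneg (k m : ℝ),
    sq_nonneg (|(k l : ℝ)| - |(k m : ℝ)|)]

/-- **The projector entries are bounded by `2`.** [folklore] -/
theorem norm_leraySym_le (l m : d) (k : d → ℤ) : ‖leraySym l m k‖ ≤ 2 := by
  rw [leraySym_apply, Complex.norm_real, Real.norm_eq_abs]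
  have h1 : |(if l = m then (1 : ℝ) else 0)| ≤ 1 := by split_ifs <;> simp
  have h2 : |(k l : ℝ) * (k m : ℝ) / freqNormSq k| ≤ 1 := by
    rcases eq_or_lt_of_le (FunctionSpaces.Torus.freqNormSq_nonneg k) with h0 | hpos
    · rw [← h0, div_zero, abs_zero]; exact zero_le_one
    · rw [abs_div, abs_of_pos hpos, div_le_one hpos]
      exact abs_mul_apply_le_freqNormSq k l m
  calc |(if l = m then (1 : ℝ) else 0) - (k l : ℝ) * (k m : ℝ) / freqNormSq k|
      ≤ |(if l = m then (1 : ℝ) else 0)| + |(k l : ℝ) * (k m : ℝ) / freqNormSq k| := abs_sub _ _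
    _ ≤ 1 + 1 := add_le_add h1 h2
    _ = 2 := by norm_num

/-- The projector is even in the frequency. [folklore] -/
theorem leraySym_neg (l m : d) (k : d → ℤ) : leraySym l m (-k) = leraySym l m k := by
  simp only [leraySym_apply, FunctionSpaces.Torus.freqNormSq_neg, Pi.neg_apply, Int.cast_neg, neg_mul_neg]

/-- The projector entries are real. [folklore] -/
theorem conj_leraySym (l m : d) (k : d → ℤ) : starRingEnd ℂ (leraySym l m k) = leraySym l m k := by
  rw [leraySym_apply, Complex.conj_ofReal]

omit [DecidableEq d] in
/-- `∑ₗ kₗ² = |k|²` in `ℂ`. [folklore] -/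
theorem sum_intCast_mul_self_eq (k : d → ℤ) : ∑ l, (k l : ℂ) * (k l : ℂ) = (freqNormSq k : ℂ) := by
  rw [FunctionSpaces.Torus.freqNormSq]
  push_cast
  refine Finset.sum_congr rfl fun l _ => ?_
  ring

/-- **The projected field is divergence free on the Fourier side**: `∑ₗ kₗ (P(k) G)ₗ = 0` for
every family `G` (at `k ≠ 0` because `∑ₗ kₗ Pₗₘ = kₘ - kₘ|k|²/|k|² = 0`, at `k = 0` trivially). [folklore] -/
theorem sum_intCast_mul_projSym (U : d → (d → ℤ) → ℂ) (RH : d → d → (d → ℤ) → ℂ)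
    (c : d → (d → ℤ) → ℂ) (k : d → ℤ) : ∑ l, (k l : ℂ) * projSym U RH c l k = 0 := by
  set G : d → ℂ := fun m => convSym U RH c m k with hG
  set S : ℂ := ∑ m, (k m : ℂ) * G m with hS
  have hentry : ∀ l m, leraySym l m k =
      (if l = m then 1 else 0) - (k l : ℂ) * (k m : ℂ) / (freqNormSq k : ℂ) := by
    intro l m
    rw [leraySym_apply]
    push_cast
    split_ifs <;> simp
  have hproj : ∀ l, projSym U RH c l k = G l - (k l : ℂ) * S / (freqNormSq k : ℂ) := by
    intro l
    rw [projSym_apply]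
    simp_rw [hentry, sub_mul, Finset.sum_sub_distrib]
    congr 1
    · simp [hG]
    · rw [hS, Finset.mul_sum, Finset.sum_div]
      refine Finset.sum_congr rfl fun m _ => ?_
      ring
  simp_rw [hproj, mul_sub, Finset.sum_sub_distrib]
  rw [← hS]
  have h2 : ∑ l, (k l : ℂ) * ((k l : ℂ) * S / (freqNormSq k : ℂ)) = (freqNormSq k : ℂ) * S / (freqNormSq k : ℂ) := by
    rw [← sum_intCast_mul_self_eq, Finset.sum_mul, Finset.sum_div]
    refine Finset.sum_congr rfl fun l _ => ?_
    ring
  rw [h2]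
  rcases eq_or_ne (freqNormSq k : ℂ) 0 with h0 | h0
  · -- `k = 0`: then `S = 0`
    have hk : ∀ l, (k l : ℂ) = 0 := by
      intro l
      have hr : freqNormSq k = 0 := by exact_mod_cast h0
      have hl := sq_apply_le_freqNormSq k l
      rw [hr] at hl
      have : (k l : ℝ) = 0 := by nlinarith [sq_nonneg (k l : ℝ)]
      exact_mod_cast this
    have hS0 : S = 0 := by rw [hS]; simp [hk]
    rw [hS0]; simp
  · field_simp
    ring

/-- **The pressure identity** `-(P G)ₗ + Gₗ + 2πikₗ q̂ = 0` at every frequency (including `k = 0`,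
where `P = 1`, `2πikₗ = 0`, `q̂ = 0`): the Fourier form of `ℙ = 1 - ∇Δ⁻¹div` with
`q = -Δ⁻¹ div G`, i.e. `Δq = -div G` (Lemarié-Rieusset 2016, §6.1). [folklore] -/
theorem projSym_pressure_identity (U : d → (d → ℤ) → ℂ) (RH : d → d → (d → ℤ) → ℂ)
    (c : d → (d → ℤ) → ℂ) (l : d) (k : d → ℤ) :
    -projSym U RH c l k + convSym U RH c l k + dsym l k * presCoef U RH c k = 0 := by
  set G : d → ℂ := fun m => convSym U RH c m k with hG
  set S : ℂ := ∑ m, (k m : ℂ) * G m with hS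
  have hentry : ∀ m, leraySym l m k =
      (if l = m then 1 else 0) - (k l : ℂ) * (k m : ℂ) / (freqNormSq k : ℂ) := by
    intro m
    rw [leraySym_apply]
    push_cast
    split_ifs <;> simp
  have hproj : projSym U RH c l k = G l - (k l : ℂ) * S / (freqNormSq k : ℂ) := by
    rw [projSym_apply]
    simp_rw [hentry, sub_mul, Finset.sum_sub_distrib]
    congr 1
    · simp [hG]
    · rw [hS, Finset.mul_sum, Finset.sum_div]
      refine Finset.sum_congr rfl fun m _ => ?_
      ring
  have hpres : presCoef U RH c k = -S / (2 * π * Complex.I * (freqNormSq k : ℂ)) := rfl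
  rw [hproj, hpres, dsym_apply]
  change -(G l - (k l : ℂ) * S / (freqNormSq k : ℂ)) + G l +
    2 * π * Complex.I * (k l : ℂ) * (-S / (2 * π * Complex.I * (freqNormSq k : ℂ))) = 0
  rcases eq_or_ne (freqNormSq k : ℂ) 0 with h0 | h0
  · rw [h0]; simp
  · have h2pi : (2 * π * Complex.I : ℂ) ≠ 0 := by
      simp [Real.pi_ne_zero, Complex.I_ne_zero]
    field_simp
    ring

end Leray

/-! ### Decay of the symbols -/

section Decay

variable {K : ℕ} {A₀ A X₀ X B : ℝ} {U : d → (d → ℤ) → ℂ} {RH : d → d → (d → ℤ) → ℂ}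
  {c : d → (d → ℤ) → ℂ}

omit [DecidableEq d] in
/-- The transport constant `Tᴷ(A, A₀; X, X₀) = #d · 2ᴷ latMass (A · 2πX₀ + A₀ · 2πX)` of
`hasDecay_transportSym` is nonnegative. [folklore] -/
theorem transport_const_nonneg (K : ℕ) (hA₀ : 0 ≤ A₀) (hA : 0 ≤ A) (hX₀ : 0 ≤ X₀) (hX : 0 ≤ X) :
    0 ≤ Fintype.card d * (2 ^ K * latMass d * (A * (2 * π * X₀) + A₀ * (2 * π * X))) := by
  have := latMass_nonneg (d := d)
  positivity

omit [DecidableEq d] in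
/-- Decay of the stress forcing `∑ⱼ 2πikⱼ RHₗⱼ`: order `K` from order `K + 1`. [folklore] -/
theorem hasDecay_forcing (hR : ∀ i j, HasDecay (K + 1) B (RH i j)) (l : d) :
    HasDecay K (Fintype.card d * (2 * π * B)) (fun k => ∑ j, dsym j k * RH l j k) := by
  intro k
  have h : ∀ j ∈ (Finset.univ : Finset d), HasDecay K (2 * π * B) (fun k => dsym j k * RH l j k) :=
    fun j _ => hasDecay_dsym_mul (hR l j) j
  have h2 := FourierNS.hasDecay_finset_sum Finset.univ h k
  rw [Finset.sum_const, Finset.card_univ, nsmul_eq_mul] at h2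
  simpa only [Finset.sum_apply] using h2

omit [DecidableEq d] in
/-- **Decay of the convective symbol.** If the velocity coefficients decay to orders
`2#d + 1` (constant `X₀`) and `K + 1` (constant `X`), the drift coefficients to the same orders
(constants `A₀`, `A`) and the stress coefficients to order `K + 1` (constant `B`), then
`convSym` decays to order `K` with the constant
`Tᴷ(X,X₀;X,X₀) + Tᴷ(A,A₀;X,X₀) + Tᴷ(X,X₀;A,A₀) + #d·2πB` — linear in each of `X`, `A`, `B`. [folklore] -/
theorem hasDecay_convSym (hA : 0 ≤ A) (hX : 0 ≤ X)
    (hU₀ : ∀ j, HasDecay (latOrder d + 1) A₀ (U j)) (hU : ∀ j, HasDecay (K + 1) A (U j))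
    (hc₀ : ∀ j, HasDecay (latOrder d + 1) X₀ (c j)) (hc : ∀ j, HasDecay (K + 1) X (c j))
    (hR : ∀ i j, HasDecay (K + 1) B (RH i j)) (l : d) :
    HasDecay K
      (Fintype.card d * (2 ^ K * latMass d * (X * (2 * π * X₀) + X₀ * (2 * π * X))) +
        Fintype.card d * (2 ^ K * latMass d * (A * (2 * π * X₀) + A₀ * (2 * π * X))) +
        Fintype.card d * (2 ^ K * latMass d * (X * (2 * π * A₀) + X₀ * (2 * π * A))) +
        Fintype.card d * (2 * π * B))
      (convSym U RH c l) := by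
  have h1 : HasDecay K (Fintype.card d * (2 ^ K * latMass d * (X * (2 * π * X₀) + X₀ * (2 * π * X))))
      (transportSym c (c l)) :=
    hasDecay_transportSym (fun j => (hc₀ j).of_le (by omega)) (fun j => (hc j).of_le (by omega)) hX
      (hc₀ l) (hc l) hX
  have h2 : HasDecay K (Fintype.card d * (2 ^ K * latMass d * (A * (2 * π * X₀) + A₀ * (2 * π * X))))
      (transportSym U (c l)) :=
    hasDecay_transportSym (fun j => (hU₀ j).of_le (by omega)) (fun j => (hU j).of_le (by omega)) hA
      (hc₀ l) (hc l) hX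
  have h3 : HasDecay K (Fintype.card d * (2 ^ K * latMass d * (X * (2 * π * A₀) + X₀ * (2 * π * A))))
      (transportSym c (U l)) :=
    hasDecay_transportSym (fun j => (hc₀ j).of_le (by omega)) (fun j => (hc j).of_le (by omega)) hX
      (hU₀ l) (hU l) hA
  have h4 := hasDecay_forcing hR l
  intro k
  rw [convSym_apply]
  exact norm_add_le_of_le (norm_add_le_of_le (norm_add_le_of_le (h1 k) (h2 k)) (h3 k)) (h4 k)
    |>.trans (le_of_eq (by ring))

/-- **Decay of the projected symbol**: the projector costs the factor `2#d`. [folklore] -/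
theorem hasDecay_projSym_of_convSym {C : ℝ} (hC : ∀ m, HasDecay K C (convSym U RH c m)) (l : d) :
    HasDecay K (2 * Fintype.card d * C) (projSym U RH c l) := by
  intro k
  rw [projSym_apply]
  have hC0 : 0 ≤ C := by
    rcases isEmpty_or_nonempty d with h | ⟨⟨m⟩⟩
    · exact (hC l).nonneg
    · exact (hC m).nonneg
  calc ‖∑ m, leraySym l m k * convSym U RH c m k‖
      ≤ ∑ m, ‖leraySym l m k * convSym U RH c m k‖ := norm_sum_le _ _
    _ ≤ ∑ _m : d, 2 * (C * ((1 + ‖k‖) ^ K)⁻¹) := Finset.sum_le_sum fun m _ => by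
        rw [norm_mul]
        exact mul_le_mul (norm_leraySym_le l m k) (hC m k) (norm_nonneg _) zero_le_two
    _ = 2 * Fintype.card d * C * ((1 + ‖k‖) ^ K)⁻¹ := by
        rw [Finset.sum_const, Finset.card_univ, nsmul_eq_mul]; ring

end Decay

/-! ### Linearity and Lipschitz bounds in the velocity coefficients -/

section Lipschitz

variable {K : ℕ} {A₀ A X₀ X B : ℝ} {U : d → (d → ℤ) → ℂ} {RH : d → d → (d → ℤ) → ℂ}
  {c c' : d → (d → ℤ) → ℂ}

omit [Fintype d] [DecidableEq d] in
/-- Subtraction in the first argument of `lconv` (summable families). [folklore] -/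
theorem lconv_sub_left {f₁ f₂ g : (d → ℤ) → ℂ} (k : d → ℤ) (h₁ : Summable fun m => f₁ m * g (k - m))
    (h₂ : Summable fun m => f₂ m * g (k - m)) :
    lconv (fun m => f₁ m - f₂ m) g k = lconv f₁ g k - lconv f₂ g k := by
  simp only [lconv_apply, sub_mul]
  exact h₁.tsum_sub h₂

omit [DecidableEq d] in
/-- The transport symbol is linear in the drift coefficients: differences. [folklore] -/
theorem transportSym_sub_left {U₁ U₂ : d → (d → ℤ) → ℂ} {c₀ : (d → ℤ) → ℂ} {A₁ A₂ X₁ : ℝ}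
    (hU₁ : ∀ j, HasDecay (latOrder d) A₁ (U₁ j)) (hU₂ : ∀ j, HasDecay (latOrder d) A₂ (U₂ j))
    (hc : HasDecay (latOrder d + 1) X₁ c₀) (k : d → ℤ) :
    transportSym U₁ c₀ k - transportSym U₂ c₀ k = transportSym (fun j m => U₁ j m - U₂ j m) c₀ k := by
  rw [transportSym_apply, transportSym_apply, transportSym_apply, ← Finset.sum_sub_distrib]
  refine Finset.sum_congr rfl fun j _ => ?_
  have h₁ := summable_lconv_term (g := fun m => dsym j m * c₀ m) (hU₁ j)
    (hasDecay_dsym_mul hc j).norm_le k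
  have h₂ := summable_lconv_term (g := fun m => dsym j m * c₀ m) (hU₂ j)
    (hasDecay_dsym_mul hc j).norm_le k
  exact (lconv_sub_left (f₁ := U₁ j) (f₂ := U₂ j) (g := fun m => dsym j m * c₀ m) k h₁ h₂).symm

omit [DecidableEq d] in
/-- **The convective symbol is affine-quadratic in the velocity coefficients**: the difference
`G(c) - G(c')` is the sum of transport symbols in which exactly one slot carries `c - c'`:
`N(c, cₗ - c'ₗ) + N(c - c', c'ₗ) + N(U, cₗ - c'ₗ) + N(c - c', Uₗ)`. [folklore] -/
theorem convSym_sub {X₁ X₂ : ℝ} (hU : ∀ j, HasDecay (latOrder d + 1) A₀ (U j))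
    (hc : ∀ j, HasDecay (latOrder d + 1) X₁ (c j)) (hc' : ∀ j, HasDecay (latOrder d + 1) X₂ (c' j))
    (l : d) (k : d → ℤ) :
    convSym U RH c l k - convSym U RH c' l k =
      transportSym c (fun m => c l m - c' l m) k + transportSym (fun j m => c j m - c' j m) (c' l) k +
        transportSym U (fun m => c l m - c' l m) k +
        transportSym (fun j m => c j m - c' j m) (U l) k := by
  rw [convSym_apply, convSym_apply]
  have h1 : transportSym c (c l) k - transportSym c' (c' l) k =
      transportSym c (fun m => c l m - c' l m) k + transportSym (fun j m => c j m - c' j m) (c' l) k := by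
    have e1 := transportSym_sub (U := c) (fun j => (hc j).of_le (by omega)) (hc l) (hc' l) k
    have e2 := transportSym_sub_left (c₀ := c' l) (fun j => (hc j).of_le (by omega))
      (fun j => (hc' j).of_le (by omega)) (hc' l) k
    linear_combination e1 + e2
  have h2 := transportSym_sub (U := U) (fun j => (hU j).of_le (by omega)) (hc l) (hc' l) k
  have h3 := transportSym_sub_left (c₀ := U l) (fun j => (hc j).of_le (by omega))
    (fun j => (hc' j).of_le (by omega)) (hU l) k
  linear_combination h1 + h2 + h3

omit [DecidableEq d] in
/-- **Lipschitz bound for the convective symbol.** With `c`, `c'` decaying to orders `2#d+1`,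
`K+1` (constants `X₀`, `X`; `X₀'`, `X'`), `U` likewise (`A₀`, `A`), and the difference
`e = c - c'` to orders `2#d + 1` (`E₀`) and `K + 1` (`E`), the difference `G(c) - G(c')` decays
to order `K` with a constant linear in `(E₀, E)`. [folklore] -/
theorem hasDecay_convSym_sub {X₀' X' E₀ E : ℝ} (hA : 0 ≤ A) (hX : 0 ≤ X) (hX' : 0 ≤ X')
    (hE : 0 ≤ E) (hU₀ : ∀ j, HasDecay (latOrder d + 1) A₀ (U j)) (hU : ∀ j, HasDecay (K + 1) A (U j))
    (hc₀ : ∀ j, HasDecay (latOrder d + 1) X₀ (c j)) (hc : ∀ j, HasDecay (K + 1) X (c j))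
    (hc'₀ : ∀ j, HasDecay (latOrder d + 1) X₀' (c' j)) (hc' : ∀ j, HasDecay (K + 1) X' (c' j))
    (he₀ : ∀ j, HasDecay (latOrder d + 1) E₀ (fun m => c j m - c' j m))
    (he : ∀ j, HasDecay (K + 1) E (fun m => c j m - c' j m)) (l : d) :
    HasDecay K
      (Fintype.card d * (2 ^ K * latMass d * (X * (2 * π * E₀) + X₀ * (2 * π * E))) +
        Fintype.card d * (2 ^ K * latMass d * (E * (2 * π * X₀') + E₀ * (2 * π * X'))) +
        Fintype.card d * (2 ^ K * latMass d * (A * (2 * π * E₀) + A₀ * (2 * π * E))) +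
        Fintype.card d * (2 ^ K * latMass d * (E * (2 * π * A₀) + E₀ * (2 * π * A))))
      (fun k => convSym U RH c l k - convSym U RH c' l k) := by
  have h1 : HasDecay K (Fintype.card d * (2 ^ K * latMass d * (X * (2 * π * E₀) + X₀ * (2 * π * E))))
      (transportSym c (fun m => c l m - c' l m)) :=
    hasDecay_transportSym (fun j => (hc₀ j).of_le (by omega)) (fun j => (hc j).of_le (by omega)) hX
      (he₀ l) (he l) hE
  have h2 : HasDecay K (Fintype.card d * (2 ^ K * latMass d * (E * (2 * π * X₀') + E₀ * (2 * π * X'))))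
      (transportSym (fun j m => c j m - c' j m) (c' l)) :=
    hasDecay_transportSym (fun j => (he₀ j).of_le (by omega)) (fun j => (he j).of_le (by omega)) hE
      (hc'₀ l) (hc' l) hX'
  have h3 : HasDecay K (Fintype.card d * (2 ^ K * latMass d * (A * (2 * π * E₀) + A₀ * (2 * π * E))))
      (transportSym U (fun m => c l m - c' l m)) :=
    hasDecay_transportSym (fun j => (hU₀ j).of_le (by omega)) (fun j => (hU j).of_le (by omega)) hA
      (he₀ l) (he l) hE
  have h4 : HasDecay K (Fintype.card d * (2 ^ K * latMass d * (E * (2 * π * A₀) + E₀ * (2 * π * A))))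
      (transportSym (fun j m => c j m - c' j m) (U l)) :=
    hasDecay_transportSym (fun j => (he₀ j).of_le (by omega)) (fun j => (he j).of_le (by omega)) hE
      (hU₀ l) (hU l) hA
  intro k
  change ‖convSym U RH c l k - convSym U RH c' l k‖ ≤ _
  rw [convSym_sub hU₀ hc₀ hc'₀ l k]
  exact (norm_add_le_of_le (norm_add_le_of_le (norm_add_le_of_le (h1 k) (h2 k)) (h3 k)) (h4 k)).trans
    (le_of_eq (by ring))

/-- Differences of projected symbols are projected differences. [folklore] -/
theorem projSym_sub (l : d) (k : d → ℤ) :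
    projSym U RH c l k - projSym U RH c' l k =
      ∑ m, leraySym l m k * (convSym U RH c m k - convSym U RH c' m k) := by
  rw [projSym_apply, projSym_apply, ← Finset.sum_sub_distrib]
  refine Finset.sum_congr rfl fun m _ => ?_
  ring

/-- **Lipschitz bound for the projected symbol**: the projector costs the factor `2#d`. [folklore] -/
theorem hasDecay_projSym_sub {C : ℝ}
    (hC : ∀ m, HasDecay K C (fun k => convSym U RH c m k - convSym U RH c' m k)) (l : d) :
    HasDecay K (2 * Fintype.card d * C) (fun k => projSym U RH c l k - projSym U RH c' l k) := by
  intro k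
  change ‖projSym U RH c l k - projSym U RH c' l k‖ ≤ _
  rw [projSym_sub l k]
  calc ‖∑ m, leraySym l m k * (convSym U RH c m k - convSym U RH c' m k)‖
      ≤ ∑ m, ‖leraySym l m k * (convSym U RH c m k - convSym U RH c' m k)‖ := norm_sum_le _ _
    _ ≤ ∑ _m : d, 2 * (C * ((1 + ‖k‖) ^ K)⁻¹) := Finset.sum_le_sum fun m _ => by
        rw [norm_mul]
        exact mul_le_mul (norm_leraySym_le l m k) (hC m k) (norm_nonneg _) zero_le_two
    _ = 2 * Fintype.card d * C * ((1 + ‖k‖) ^ K)⁻¹ := by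
        rw [Finset.sum_const, Finset.card_univ, nsmul_eq_mul]; ring

end Lipschitz

/-! ### Continuity in time -/

section Continuity

variable {Y : Type*} [TopologicalSpace Y] {A X B : ℝ}

omit [DecidableEq d] in
/-- Continuity in a parameter of the convective symbol (continuous fields with uniform decay of
order `2#d + 1`, stress of order `2#d + 1`). [folklore] -/
theorem continuous_convSym_param {U : Y → d → (d → ℤ) → ℂ} {RH : Y → d → d → (d → ℤ) → ℂ}
    {c : Y → d → (d → ℤ) → ℂ} (hU : ∀ j m, Continuous fun y => U y j m)
    (hR : ∀ i j m, Continuous fun y => RH y i j m) (hc : ∀ j m, Continuous fun y => c y j m)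
    (hUd : ∀ y j, HasDecay (latOrder d + 1) A (U y j)) (hcd : ∀ y j, HasDecay (latOrder d + 1) X (c y j))
    (l : d) (k : d → ℤ) : Continuous fun y => convSym (U y) (RH y) (c y) l k := by
  simp only [convSym_apply]
  refine ((Continuous.add ?_ ?_).add ?_).add ?_
  · exact continuous_transportSym_param (U := fun y => c y) (c := fun y => c y l) hc (hc l)
      (fun y j => (hcd y j).of_le (by omega)) (fun y => hcd y l) k
  · exact continuous_transportSym_param (U := fun y => U y) (c := fun y => c y l) hU (hc l)
      (fun y j => (hUd y j).of_le (by omega)) (fun y => hcd y l) k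
  · exact continuous_transportSym_param (U := fun y => c y) (c := fun y => U y l) hc (hU l)
      (fun y j => (hcd y j).of_le (by omega)) (fun y => hUd y l) k
  · exact continuous_finsetSum _ fun j _ => continuous_const.mul (hR l j k)

/-- Continuity in a parameter of the projected symbol. [folklore] -/
theorem continuous_projSym_param {U : Y → d → (d → ℤ) → ℂ} {RH : Y → d → d → (d → ℤ) → ℂ}
    {c : Y → d → (d → ℤ) → ℂ} (hU : ∀ j m, Continuous fun y => U y j m)
    (hR : ∀ i j m, Continuous fun y => RH y i j m) (hc : ∀ j m, Continuous fun y => c y j m)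
    (hUd : ∀ y j, HasDecay (latOrder d + 1) A (U y j)) (hcd : ∀ y j, HasDecay (latOrder d + 1) X (c y j))
    (l : d) (k : d → ℤ) : Continuous fun y => projSym (U y) (RH y) (c y) l k := by
  simp only [projSym_apply]
  exact continuous_finsetSum _ fun m _ =>
    continuous_const.mul (continuous_convSym_param hU hR hc hUd hcd m k)

end Continuity

end CorrectorFourier

end Literature.Analysis.FluidPDE

end
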